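import Summits.Schanuel.Schanuel.Theorems.ZilberEacComplexMovingPolydisc
import Literature.ModelTheory.Zilber.EACRotundityProofs
import Literature.ModelTheory.Zilber.EACDensityFamilies
import HarnessLib

/-!
# The moving-target line family `W(a, b; A, F)`: definitions and lattice-centre control

Zilber's Exponential-Algebraic Closedness, case ladder (host summit Schanuel, cell `pub-schanuel`,
seat 2, gen 8).  Infrastructure for `ZilberEacMovingLine` (density of the exponential points of
the NON-SPLIT surfaces `W(a, b; A, F) = {x₁ = a x₀ + b, y₀ = A(x₀) + y₁ F(y₁)} ⊆ ℂ² × ℂ²`, the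
first non-product family for Mantova–Masser's density question, PLMS 2024 §1 "Further remarks"):

* Part 0 — univariate polynomials as `MvPolynomial (Fin 1) ℂ`: `A.toMvPolynomial 0` is the inverse
  of `uniqueAlgEquiv`, its total degree is `deg A`, its leading form is `lc(A) X₀^{deg A}`
  (`eval_leadingForm_toMvPolynomial_fin_one`, the hypothesis format of the lattice theorems
  `latticeValue_control` / THEOREMS R, R⁺ / the oscillatory-base theorem), and `p ↦ p(A)` is
  injective for non-constant `A` (`aeval_toMvPolynomial_fin_one_injective`, seat 1's "dominant `A`").
* Part 1 — `movingLineSurface a b A F := polyFibredGraph (a X₀ + b) (A) (F)` (seat 1's certified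
  family with `s = 1`), membership in coordinates, irreducibility, `dim = 2`, and the exponential
  points `mlPoint a b x = (x, a x + b, e^{x}, e^{a x + b})`.
* Part 2 — `latticeCentre_control`: within `1/2` of the lattice centre `2πi q m + log A(2πi q m)`
  one has `|Re x - deg A · log m| ≤ C` and `|Im x - 2π q m| ≤ C`; `exists_controlled_solutions`
  packages eventual solutions near the centres into a sequence indexed by all `m`.

HONEST FRAMING: bookkeeping for instances of an OPEN question; `EC(3,2)` OPEN; NOT Schanuel's
conjecture; EAC ⇏ SC.
-/

noncomputable section

open Complex MvPolynomial Filter Topology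
open Literature.NumberTheory.Transcendental Literature.ModelTheory.Zilber

set_option linter.dupNamespace false

namespace Summit.Schanuel.Schanuel.Theorems

/-! ## Part 0. Univariate polynomials as `MvPolynomial (Fin 1) ℂ` -/

section FinOne

/-- `A.toMvPolynomial 0` is the inverse of `uniqueAlgEquiv ℂ (Fin 1)`. [folklore] -/
theorem toMvPolynomial_fin_one_eq_symm (A : Polynomial ℂ) :
    A.toMvPolynomial (0 : Fin 1) = (MvPolynomial.uniqueAlgEquiv ℂ (Fin 1)).symm A := by
  have h : (Polynomial.toMvPolynomial (0 : Fin 1) : Polynomial ℂ →ₐ[ℂ] MvPolynomial (Fin 1) ℂ) =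
      ((MvPolynomial.uniqueAlgEquiv ℂ (Fin 1)).symm : Polynomial ℂ →ₐ[ℂ] MvPolynomial (Fin 1) ℂ) := by
    refine Polynomial.algHom_ext ?_
    rw [Polynomial.toMvPolynomial_X]
    have h1 := @MvPolynomial.uniqueAlgEquiv_symm_monomial ℂ (Fin 1) _ _
      (Finsupp.single (0 : Fin 1) 1) (1 : ℂ)
    rw [Fin.default_eq_zero, Finsupp.single_eq_same, Polynomial.monomial_one_one_eq_X] at h1
    rw [AlgEquiv.coe_toAlgHom, h1, MvPolynomial.X, MvPolynomial.monomial_eq]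
  exact DFunLike.congr_fun h A

/-- Coefficients of `A.toMvPolynomial 0`. [folklore] -/
theorem coeff_toMvPolynomial_fin_one (A : Polynomial ℂ) (d : Fin 1 →₀ ℕ) :
    coeff d (A.toMvPolynomial (0 : Fin 1)) = A.coeff (d 0) := by
  rw [toMvPolynomial_fin_one_eq_symm, MvPolynomial.coeff_uniqueAlgEquiv_symm, Fin.default_eq_zero]

/-- `deg (A.toMvPolynomial 0) = deg A`. [folklore] -/
theorem totalDegree_toMvPolynomial_fin_one (A : Polynomial ℂ) :
    (A.toMvPolynomial (0 : Fin 1)).totalDegree = A.natDegree := by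
  apply le_antisymm
  · refine Finset.sup_le fun d hd => ?_
    rw [MvPolynomial.mem_support_iff, coeff_toMvPolynomial_fin_one] at hd
    have h1 : (d.sum fun _ e => e) = d 0 := by
      conv_lhs => rw [Finsupp.unique_single d]
      rw [Finsupp.sum_single_index rfl, Fin.default_eq_zero]
    rw [h1]
    exact Polynomial.le_natDegree_of_ne_zero hd
  · by_cases hA : A = 0
    · simp [hA]
    · have hmem : Finsupp.single (0 : Fin 1) A.natDegree ∈ (A.toMvPolynomial (0 : Fin 1)).support := by
        rw [MvPolynomial.mem_support_iff, coeff_toMvPolynomial_fin_one, Finsupp.single_eq_same]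
        exact Polynomial.leadingCoeff_ne_zero.2 hA
      have := MvPolynomial.le_totalDegree hmem
      rwa [Finsupp.sum_single_index rfl] at this

/-- In one variable the homogeneous component of degree `n` is the single monomial `P_n X₀ⁿ`.
[folklore] -/
theorem homogeneousComponent_fin_one (P : MvPolynomial (Fin 1) ℂ) (n : ℕ) :
    homogeneousComponent n P = monomial (Finsupp.single 0 n) (coeff (Finsupp.single 0 n) P) := by
  ext d
  rw [coeff_homogeneousComponent, coeff_monomial]
  have hd : d = Finsupp.single 0 (d 0) := by
    conv_lhs => rw [Finsupp.unique_single d]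
    rw [Fin.default_eq_zero]
  have hdeg : d.degree = d 0 := by rw [hd, Finsupp.degree_single, Finsupp.single_eq_same]
  by_cases h : d 0 = n
  · rw [if_pos (hdeg.trans h), if_pos (by rw [hd, h])]
    rw [hd, h]
  · rw [if_neg (by rwa [hdeg]), if_neg]
    intro h'
    apply h
    rw [← h', Finsupp.single_eq_same]

/-- **The leading form of a univariate polynomial**: `(A.toMvPolynomial 0)_{deg}(v) = lc(A) v₀^{deg A}`.
[folklore] -/
theorem eval_leadingForm_toMvPolynomial_fin_one (A : Polynomial ℂ) (v : Fin 1 → ℂ) :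
    eval v (homogeneousComponent (A.toMvPolynomial (0 : Fin 1)).totalDegree
      (A.toMvPolynomial (0 : Fin 1))) = A.leadingCoeff * v 0 ^ A.natDegree := by
  rw [totalDegree_toMvPolynomial_fin_one, homogeneousComponent_fin_one, coeff_toMvPolynomial_fin_one,
    Finsupp.single_eq_same, eval_monomial, Finsupp.prod_single_index]
  · rfl
  · exact pow_zero _

/-- It does not vanish at `v` with `v₀ ≠ 0` (`A ≠ 0`). [folklore] -/
theorem eval_leadingForm_toMvPolynomial_fin_one_ne_zero {A : Polynomial ℂ} (hA : A ≠ 0)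
    {v : Fin 1 → ℂ} (hv : v 0 ≠ 0) :
    eval v (homogeneousComponent (A.toMvPolynomial (0 : Fin 1)).totalDegree
      (A.toMvPolynomial (0 : Fin 1))) ≠ 0 := by
  rw [eval_leadingForm_toMvPolynomial_fin_one]
  exact mul_ne_zero (Polynomial.leadingCoeff_ne_zero.2 hA) (pow_ne_zero _ hv)

/-- **Dominance of `p ↦ p(A)`**: for non-constant `A` the substitution `X₀ ↦ A(X₀)` is injective on
`MvPolynomial (Fin 1) ℂ`. [folklore] -/
theorem aeval_toMvPolynomial_fin_one_injective {A : Polynomial ℂ} (hA : 0 < A.natDegree) :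
    Function.Injective (aeval ![A.toMvPolynomial (0 : Fin 1)] :
      MvPolynomial (Fin 1) ℂ →ₐ[ℂ] MvPolynomial (Fin 1) ℂ) := by
  set e := MvPolynomial.uniqueAlgEquiv ℂ (Fin 1) with he
  rw [injective_iff_map_eq_zero]
  intro p hp
  have hp' : p = (e p).toMvPolynomial (0 : Fin 1) := by
    rw [toMvPolynomial_fin_one_eq_symm, AlgEquiv.symm_apply_apply]
  rw [hp', MvPolynomial.aeval_toMvPolynomial, Matrix.cons_val_fin_one,
    Polynomial.aeval_algHom_apply, ← Polynomial.comp_eq_aeval,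
    map_eq_zero_iff _ (Polynomial.toMvPolynomial_injective _), Polynomial.comp_eq_zero_iff] at hp
  rcases hp with h | ⟨-, h⟩
  · rw [hp', h, map_zero]
  · exfalso
    have : A.natDegree = 0 := by rw [h, Polynomial.natDegree_C]
    omega

end FinOne

/-! ## Part 1. The moving-target line surfaces `W(a, b; A, F)` -/

section Surface

/-- The line base `a X₀ + b` (seat 1's `linePoly a b`) as an element of
`ℂ[X₀] = MvPolynomial (Fin 1) ℂ`. [folklore] -/
def linBase (a b : ℂ) : MvPolynomial (Fin 1) ℂ := (linePoly a b).toMvPolynomial 0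

/-- Evaluation of the line base. [folklore] -/
@[simp] theorem eval_linBase (a b : ℂ) (x : Fin 1 → ℂ) : eval x (linBase a b) = a * x 0 + b := by
  rw [linBase, MvPolynomial.eval_toMvPolynomial, eval_linePoly]

/-- The line base has total degree `1` (`a ≠ 0`). [folklore] -/
theorem totalDegree_linBase {a : ℂ} (ha : a ≠ 0) (b : ℂ) : (linBase a b).totalDegree = 1 := by
  rw [linBase, totalDegree_toMvPolynomial_fin_one, linePoly, Polynomial.natDegree_linear ha]

/-- Its leading form at `v` is `a v₀`. [folklore] -/
theorem eval_leadingForm_linBase {a : ℂ} (ha : a ≠ 0) (b : ℂ) (v : Fin 1 → ℂ) :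
    eval v (homogeneousComponent (linBase a b).totalDegree (linBase a b)) = a * v 0 := by
  rw [linBase, eval_leadingForm_toMvPolynomial_fin_one, linePoly, Polynomial.leadingCoeff_linear ha,
    Polynomial.natDegree_linear ha, pow_one]

/-- **The moving-target line surface** `W(a, b; A, F) = {x₁ = a x₀ + b, y₀ = A(x₀) + y₁ F(y₁)}`,
literally seat 1's `polyFibredGraph` with `s = 1`, base `a X₀ + b`, additive coefficient `A` and
fibre polynomial `F(u)` — so irreducibility, dimension, dominant multiplicative projection etc. are
inherited.  Its exponential points are the solutions of `e^{z} = A(z) + e^{a z + b} F(e^{a z + b})`.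
[cite: MantovaMasser2023, §1 Further remarks] -/
def movingLineSurface (a b : ℂ) (A F : Polynomial ℂ) : Set (Fin 2 ⊕ Fin 2 → ℂ) :=
  polyFibredGraph (linBase a b) ![A.toMvPolynomial 0] ![F.toMvPolynomial 0]

variable (a b : ℂ) (A F : Polynomial ℂ)

/-- Membership in `W(a, b; A, F)` in coordinates. [folklore] -/
theorem mem_movingLineSurface_iff (z : Fin 2 ⊕ Fin 2 → ℂ) :
    z ∈ movingLineSurface a b A F ↔
      z (Sum.inl 1) = a * z (Sum.inl 0) + b ∧
        z (Sum.inr 0) = A.eval (z (Sum.inl 0)) + z (Sum.inr 1) * F.eval (z (Sum.inr 1)) := by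
  rw [movingLineSurface, mem_polyFibredGraph_iff, Fin.forall_fin_one]
  simp only [Matrix.cons_val_fin_one, MvPolynomial.eval_toMvPolynomial, Fin.cons_zero, eval_linBase]
  rfl

/-- `W(a, b; A, F)` is irreducible Zariski closed. [folklore] -/
theorem isIrreducibleClosed_movingLineSurface : IsIrreducibleClosed ℂ (movingLineSurface a b A F) :=
  isIrreducibleClosed_polyFibredGraph _ _ _

/-- `dim W(a, b; A, F) = 2`. [folklore] -/
theorem zariskiDim_movingLineSurface : zariskiDim ℂ (movingLineSurface a b A F) = (2 : ℕ) :=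
  zariskiDim_polyFibredGraph _ _ _

variable {a b A F}

/-- The point of `ℂ² × ℂ²` over `x₀ = x` on the line, with its exponentials. [folklore] -/
def mlPoint (a b x : ℂ) : Fin 2 ⊕ Fin 2 → ℂ :=
  Sum.elim ![x, a * x + b] ![exp x, exp (a * x + b)]

/-- Coordinate `x₀` of `mlPoint`. [folklore] -/
@[simp] theorem mlPoint_inl_zero (a b x : ℂ) : mlPoint a b x (Sum.inl 0) = x := rfl

/-- Coordinate `x₁` of `mlPoint`. [folklore] -/
@[simp] theorem mlPoint_inl_one (a b x : ℂ) : mlPoint a b x (Sum.inl 1) = a * x + b := rfl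

/-- Coordinate `y₀` of `mlPoint`. [folklore] -/
@[simp] theorem mlPoint_inr_zero (a b x : ℂ) : mlPoint a b x (Sum.inr 0) = exp x := rfl

/-- Coordinate `y₁` of `mlPoint`. [folklore] -/
@[simp] theorem mlPoint_inr_one (a b x : ℂ) : mlPoint a b x (Sum.inr 1) = exp (a * x + b) := rfl

/-- `mlPoint a b x` is an exponential point. [folklore] -/
theorem mlPoint_mem_expGraph (a b x : ℂ) : mlPoint a b x ∈ expGraph ℂ 2 := by
  rw [mem_expGraph_iff]
  intro i
  rw [Literature.ModelTheory.ExponentialFields.ExponentialRing.complex_exp_eq]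
  fin_cases i <;> rfl

/-- … and lies on `W(a, b; A, F)` exactly when `x` solves `e^{x} = A(x) + e^{ax+b} F(e^{ax+b})`.
[folklore] -/
theorem mlPoint_mem_iff (a b : ℂ) (A F : Polynomial ℂ) (x : ℂ) :
    mlPoint a b x ∈ movingLineSurface a b A F ↔
      exp x = A.eval x + exp (a * x + b) * F.eval (exp (a * x + b)) := by
  rw [mem_movingLineSurface_iff]
  simp

end Surface

/-! ## Part 2. Control of `Re x` and `Im x` near the lattice centres -/

section Lattice

/-- The lattice point `2πi q m` has real part `0`. [folklore] -/
theorem re_natCast_mul_twoPiI_intCast (m : ℕ) (q : ℤ) :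
    ((m : ℂ) * (2 * Real.pi * I * (q : ℂ))).re = 0 := by
  simp [Complex.mul_re]

/-- … and imaginary part `2π q m`. [folklore] -/
theorem im_natCast_mul_twoPiI_intCast (m : ℕ) (q : ℤ) :
    ((m : ℂ) * (2 * Real.pi * I * (q : ℂ))).im = 2 * Real.pi * q * m := by
  simp [Complex.mul_im]; ring

/-- **Lattice-centre control (one variable).**  For `A ≠ 0` and `q ≠ 0` there are `C` and `t₀ ≥ 1`
such that for every `m ≥ t₀` and every `x` within `1/2` of the lattice centre
`2πi q m + log A(2πi q m)`:  `|Re x - deg A · log m| ≤ C` and `|Im x - 2π q m| ≤ C`. [folklore] -/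
theorem latticeCentre_control {A : Polynomial ℂ} (hA : A ≠ 0) {q : ℤ} (hq : q ≠ 0) :
    ∃ C t₀ : ℝ, 1 ≤ t₀ ∧ ∀ m : ℕ, t₀ ≤ (m : ℝ) → ∀ x : ℂ,
      ‖x - ((m : ℂ) * (2 * Real.pi * I * (q : ℂ)) +
        log (A.eval ((m : ℂ) * (2 * Real.pi * I * (q : ℂ)))))‖ ≤ 1 / 2 →
      |x.re - A.natDegree * Real.log m| ≤ C ∧ |x.im - 2 * Real.pi * q * m| ≤ C := by
  set v : Fin 1 → ℂ := fun _ => 2 * Real.pi * I * (q : ℂ) with hv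
  have hv0 : v 0 ≠ 0 := by
    simp only [hv]
    have hpi : (Real.pi : ℂ) ≠ 0 := Complex.ofReal_ne_zero.2 Real.pi_ne_zero
    have hq' : (q : ℂ) ≠ 0 := Int.cast_ne_zero.2 hq
    exact mul_ne_zero (mul_ne_zero (mul_ne_zero two_ne_zero hpi) Complex.I_ne_zero) hq'
  have hlead := eval_leadingForm_toMvPolynomial_fin_one_ne_zero hA hv0
  obtain ⟨ρ, -, t₀, ht₀, hc⟩ := latticeValue_control (A.toMvPolynomial 0) v hlead one_pos
  set c₀ : ℝ := ‖eval v (homogeneousComponent (A.toMvPolynomial (0 : Fin 1)).totalDegree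
    (A.toMvPolynomial (0 : Fin 1)))‖ with hc₀
  have hc₀pos : 0 < c₀ := norm_pos_iff.2 hlead
  refine ⟨|Real.log (c₀ / 2)| + |Real.log (2 * c₀)| + Real.pi + 1 / 2, t₀, ht₀, fun m hm x hx => ?_⟩
  obtain ⟨-, hlow, hupp, -⟩ := hc m hm
  have hev : eval (fun i => (m : ℂ) * v i) (A.toMvPolynomial (0 : Fin 1)) =
      A.eval ((m : ℂ) * (2 * Real.pi * I * (q : ℂ))) := by
    rw [MvPolynomial.eval_toMvPolynomial]
  rw [hev, totalDegree_toMvPolynomial_fin_one] at hlow hupp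
  have hm1 : (1 : ℝ) ≤ m := ht₀.trans hm
  obtain ⟨h1, h2, -⟩ := log_latticeValue_bounds (by positivity : 0 < c₀ / 2) hm1 hlow hupp
  set α : ℂ := A.eval ((m : ℂ) * (2 * Real.pi * I * (q : ℂ))) with hα
  set ξ : ℂ := x - ((m : ℂ) * (2 * Real.pi * I * (q : ℂ)) + log α) with hξ
  have hxeq : x = ((m : ℂ) * (2 * Real.pi * I * (q : ℂ)) + log α) + ξ := by rw [hξ]; ring
  have hξre : |ξ.re| ≤ 1 / 2 := (Complex.abs_re_le_norm ξ).trans hx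
  have hξim : |ξ.im| ≤ 1 / 2 := (Complex.abs_im_le_norm ξ).trans hx
  have hre : x.re = Real.log ‖α‖ + ξ.re := by
    rw [hxeq, Complex.add_re, Complex.add_re, re_natCast_mul_twoPiI_intCast, Complex.log_re, zero_add]
  have him : x.im = 2 * Real.pi * q * m + Complex.arg α + ξ.im := by
    rw [hxeq, Complex.add_im, Complex.add_im, im_natCast_mul_twoPiI_intCast, Complex.log_im]
  have harg : |Complex.arg α| ≤ Real.pi := Complex.abs_arg_le_pi α
  rw [abs_le] at hξre hξim harg
  constructor
  · rw [hre, abs_le]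
    constructor
    · have : -|Real.log (c₀ / 2)| ≤ Real.log (c₀ / 2) := neg_abs_le _
      have : 0 ≤ |Real.log (2 * c₀)| := abs_nonneg _
      nlinarith [Real.pi_pos]
    · have : Real.log (2 * c₀) ≤ |Real.log (2 * c₀)| := le_abs_self _
      have : 0 ≤ |Real.log (c₀ / 2)| := abs_nonneg _
      nlinarith [Real.pi_pos]
  · rw [him, abs_le]
    have : 0 ≤ |Real.log (c₀ / 2)| := abs_nonneg _
    have : 0 ≤ |Real.log (2 * c₀)| := abs_nonneg _
    constructor <;> linarith

/-- **From solutions near the lattice centres to a controlled sequence of exponential points.**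
If for all large `m` the equation `e^{x} = A(x) + e^{ax+b} F(e^{ax+b})` has a solution within `1/2` of
the centre `2πi q m + log A(2πi q m)` (`A ≠ 0`, `q ≠ 0`), then there are solutions `x_m` (all
`m ∈ ℕ`) and `M_m ∈ ℕ` with `m ≤ M_m`, `M_m = m` for large `m`, and
`|Re x_m - deg A log M_m| ≤ C`, `|Im x_m - 2π q M_m| ≤ C`. [folklore] -/
theorem exists_controlled_solutions {a b : ℂ} {A F : Polynomial ℂ} (hA : A ≠ 0) {q : ℤ}
    (hq : q ≠ 0)
    (hsol : ∀ᶠ m : ℕ in atTop, ∃ x : ℂ,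
      ‖x - ((m : ℂ) * (2 * Real.pi * I * (q : ℂ)) +
        log (A.eval ((m : ℂ) * (2 * Real.pi * I * (q : ℂ)))))‖ ≤ 1 / 2 ∧
      exp x = A.eval x + exp (a * x + b) * F.eval (exp (a * x + b))) :
    ∃ (x : ℕ → ℂ) (M : ℕ → ℕ) (C : ℝ), (∀ m, m ≤ M m) ∧ (∀ᶠ m in atTop, M m = m) ∧
      (∀ m, 1 ≤ (M m : ℝ)) ∧
      (∀ m, exp (x m) = A.eval (x m) + exp (a * x m + b) * F.eval (exp (a * x m + b))) ∧
      ∀ m, |(x m).re - A.natDegree * Real.log (M m)| ≤ C ∧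
        |(x m).im - 2 * Real.pi * q * (M m)| ≤ C := by
  obtain ⟨C, t₀, ht₀, hctrl⟩ := latticeCentre_control hA hq
  obtain ⟨m₀, hm₀⟩ := eventually_atTop.1
    (hsol.and (tendsto_natCast_atTop_atTop.eventually_ge_atTop t₀))
  have hsol' : ∀ m : ℕ, ∃ x : ℂ,
      ‖x - (((max m m₀ : ℕ) : ℂ) * (2 * Real.pi * I * (q : ℂ)) +
        log (A.eval (((max m m₀ : ℕ) : ℂ) * (2 * Real.pi * I * (q : ℂ)))))‖ ≤ 1 / 2 ∧
      exp x = A.eval x + exp (a * x + b) * F.eval (exp (a * x + b)) :=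
    fun m => (hm₀ (max m m₀) (le_max_right _ _)).1
  choose xs hxs using hsol'
  refine ⟨xs, fun m => max m m₀, C, fun m => le_max_left _ _, ?_, fun m => ?_, fun m => (hxs m).2,
    fun m => hctrl _ (hm₀ _ (le_max_right _ _)).2 _ (hxs m).1⟩
  · filter_upwards [eventually_ge_atTop m₀] with m hm using max_eq_left hm
  · exact ht₀.trans (hm₀ _ (le_max_right _ _)).2

end Lattice

end Summit.Schanuel.Schanuel.Theorems

end
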